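import Literature.NumberTheory.LFunctions.WeilTwoPrimeCertificateDeflated
import Literature.NumberTheory.LFunctions.WeilBlockRowsPZ
import HarnessLib

/-!
# Row-wise kernel checks for the rank-one augmented (deflated) certificate blocks

Topic `Literature/NumberTheory/LFunctions`.  The deflated two-prime certificate (`WeilTwoPrimeCertificateDeflated.lean`)
checks the parity blocks `S' = Dᵀ P D + κ (2 diag b − (b bᵀ) ∘ H')`, `R = S' − UᵀU` (`WeilCert.spBlkP`, `rBlkP`,
`checkBlockP`) for an ARBITRARY parity-diagonal coefficient matrix `P` — in the certificates `P = P_r + Σ_i μ_i ĉ_i ĉ_iᵀ`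
(`prQ nu + rankOneQ R`).  This file re-states the row-wise evaluation scheme of `WeilBlockRows.lean`,
`WeilBlockRowsP.lean`, `WeilBlockRowsPZ.lean` (one kernel `decide` per row of `R`, from a materialized claimed block `Pm`,
the factored inverse `Dn/Ls` and the Bessel block `Hp`) for such a generic `P`:

* `WeilCert.dtpRowG`, `rRowG`, `checkDomRowG`, `checkPmRowG` — the row computations and the claim-row check
  `Pm_{kl} = P(2k+p, 2l+p)`;
* `getV_rRowG` (the row computation is row `i` of `rBlkP`), `getM_rBlkP_symm` (symmetry, for symmetric `P`),
  **`checkBlockP_of_rows`** (the block check from `D C = I` rows and one-sided dominance rows);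
* `checkDomRowG_of_P`, **`checkDomRowG_of_PZ`** — a dominance row from the materialized / factored data
  (`checkDomRowP`, `checkDomRowPZ` of the sibling files, whose row computations do not mention `P`);
* `rankOneQ_symm`, `prQ_add_rankOneQ_symm` — the augmented coefficient matrix is symmetric.

Proofs verbatim from the `P_r` versions.  All proved; no named facts.

## References
* H. Yoshida, *On Hermitian forms attached to zeta functions*, Adv. Stud. Pure Math. 21 (1992), §6. [Yoshida1992]
-/

open Finset
open scoped BigOperators

namespace Literature.NumberTheory.LFunctions

namespace WeilCert

variable (c : WeilCert)

/-! ## Row-wise computations for a generic `P` -/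

/-- Row `i` of `Dᵀ P`: `w_l = Σ_k D_{ki} P(2k+p, 2l+p)`. [folklore] -/
def dtpRowG (P : ℕ → ℕ → ℚ) (p i : ℕ) : List ℚ :=
  tabV c.nb fun l ↦ sumR c.nb fun k ↦ getM (c.Db p) k i * P (2 * k + p) (2 * l + p)

/-- Row `i` of `R = S' − UᵀU` (generic `P`) from the two row vectors. [folklore] -/
def rRowG (P : ℕ → ℕ → ℚ) (κ : ℚ) (p i : ℕ) : List ℚ :=
  let w := c.dtpRowG P p i
  let ch := c.chRow p i
  tabV c.nb fun j ↦
    ((sumR c.nb fun l ↦ getV w l * getM (c.Db p) l j) +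
        κ * ((if i = j then 2 * c.bQ p i else 0) -
          c.bQ p i * c.bQ p j * (sumR c.nb fun l ↦ getV ch l * getM (c.Cb p) j l))) -
      sumR c.nb fun k ↦ getM (c.Ub p) k i * getM (c.Ub p) k j

/-- One-sided dominance of row `i` of `R` (generic `P`): `Σ_{j ≠ i} |R_{ij}| ≤ R_{ii}`. [folklore] -/
def checkDomRowG (P : ℕ → ℕ → ℚ) (κ : ℚ) (p i : ℕ) : Bool :=
  let r := c.rRowG P κ p i
  decide ((sumR c.nb fun j ↦ if j = i then 0 else |getV r j|) ≤ getV r i)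

/-- Row `k` of the claim "`Pm` is the parity block `p` of `P`": `Pm_{kl} = P(2k+p, 2l+p)` for all `l < nb`. [folklore] -/
def checkPmRowG (P : ℕ → ℕ → ℚ) (Pm : List (List ℚ)) (p k : ℕ) : Bool :=
  allBelow c.nb fun l ↦ decide (getM Pm k l = P (2 * k + p) (2 * l + p))

variable {c}

/-! ## The row computation agrees with the materialized `R` -/

/-- Entries of the row computation are the entries of `R = S' − UᵀU` (`rBlkP`). [folklore] -/
theorem getV_rRowG (P : ℕ → ℕ → ℚ) (κ : ℚ) (p : ℕ) {i j : ℕ} (hi : i < c.nb) (hj : j < c.nb) :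
    getV (c.rRowG P κ p i) j = getM (c.rBlkP P κ p) i j := by
  rw [c.getM_rBlkP P p κ hi hj, c.getM_spBlkP P p κ hi hj, c.getM_hpBlk p hi hj]
  unfold rRowG
  dsimp only
  rw [getV_tabV _ hj, sumR_eq_sum, sumR_eq_sum, sumR_eq_sum]
  congr 1
  congr 1
  · have hw : ∀ l ∈ range c.nb, getV (c.dtpRowG P p i) l =
        ∑ k ∈ range c.nb, getM (c.Db p) k i * P (2 * k + p) (2 * l + p) := by
      intro l hl
      unfold dtpRowG
      rw [getV_tabV _ (Finset.mem_range.1 hl), sumR_eq_sum]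
    rw [Finset.sum_congr rfl fun l hl ↦ by rw [hw l hl]]
    simp_rw [Finset.sum_mul, Finset.mul_sum]
    rw [Finset.sum_comm]
    refine Finset.sum_congr rfl fun k _ ↦ Finset.sum_congr rfl fun l _ ↦ ?_
    ring
  · have hch : ∀ l ∈ range c.nb, getV (c.chRow p i) l =
        ∑ k ∈ range c.nb, getM (c.Cb p) i k * c.hBlkQ p k l := by
      intro l hl
      unfold chRow
      rw [getV_tabV _ (Finset.mem_range.1 hl), sumR_eq_sum]
    rw [Finset.sum_congr rfl fun l hl ↦ by rw [hch l hl]]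

/-! ## Symmetry -/

/-- `R = S' − UᵀU` is symmetric for a symmetric `P`. [folklore] -/
theorem getM_rBlkP_symm {P : ℕ → ℕ → ℚ} (hP : ∀ k l, P k l = P l k) (κ : ℚ) (p : ℕ) {i j : ℕ}
    (hi : i < c.nb) (hj : j < c.nb) :
    getM (c.rBlkP P κ p) i j = getM (c.rBlkP P κ p) j i := by
  rw [c.getM_rBlkP P p κ hi hj, c.getM_rBlkP P p κ hj hi, c.getM_spBlkP P p κ hi hj,
    c.getM_spBlkP P p κ hj hi, c.getM_hpBlk p hi hj, c.getM_hpBlk p hj hi]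
  have hPs : ∑ k ∈ range c.nb, getM (c.Db p) k i *
      ∑ l ∈ range c.nb, P (2 * k + p) (2 * l + p) * getM (c.Db p) l j =
      ∑ k ∈ range c.nb, getM (c.Db p) k j *
        ∑ l ∈ range c.nb, P (2 * k + p) (2 * l + p) * getM (c.Db p) l i := by
    simp_rw [Finset.mul_sum]
    rw [Finset.sum_comm]
    refine Finset.sum_congr rfl fun k _ ↦ Finset.sum_congr rfl fun l _ ↦ ?_
    rw [hP (2 * l + p) (2 * k + p)]
    ring
  have hH : ∑ l ∈ range c.nb, (∑ k ∈ range c.nb, getM (c.Cb p) i k * c.hBlkQ p k l) * getM (c.Cb p) j l =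
      ∑ l ∈ range c.nb, (∑ k ∈ range c.nb, getM (c.Cb p) j k * c.hBlkQ p k l) * getM (c.Cb p) i l := by
    simp_rw [Finset.sum_mul]
    rw [Finset.sum_comm]
    refine Finset.sum_congr rfl fun k _ ↦ Finset.sum_congr rfl fun l _ ↦ ?_
    rw [c.hBlkQ_symm p l k]
    ring
  have hU : ∑ k ∈ range c.nb, getM (c.Ub p) k i * getM (c.Ub p) k j =
      ∑ k ∈ range c.nb, getM (c.Ub p) k j * getM (c.Ub p) k i :=
    Finset.sum_congr rfl fun k _ ↦ mul_comm _ _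
  rw [hPs, hH, hU]
  by_cases hij : i = j
  · subst hij; rfl
  · rw [if_neg hij, if_neg (fun h ↦ hij h.symm)]
    ring

/-- The rank-one coefficient matrix is symmetric. [folklore] -/
theorem rankOneQ_symm (R : List (ℚ × ℕ × List ℚ)) (k l : ℕ) : rankOneQ R k l = rankOneQ R l k := by
  unfold rankOneQ
  congr 1
  refine List.map_congr_left fun r _ ↦ ?_
  ring

/-- The augmented coefficient matrix `P_r + Σ μ ĉ ĉᵀ` is symmetric. [folklore] -/
theorem prQ_add_rankOneQ_symm (nu : List ℚ) (R : List (ℚ × ℕ × List ℚ)) (k l : ℕ) :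
    c.prQ nu k l + rankOneQ R k l = c.prQ nu l k + rankOneQ R l k := by
  rw [c.prQ_symm nu k l, rankOneQ_symm R k l]

/-! ## Assembling the block check from its rows -/

/-- **`checkBlockP` from the row checks** (symmetric `P`). [folklore] -/
theorem checkBlockP_of_rows {P : ℕ → ℕ → ℚ} (hP : ∀ k l, P k l = P l k) {κ : ℚ} {p : ℕ}
    (hdc : ∀ i < c.nb, c.checkDCRow p i = true) (hdom : ∀ i < c.nb, c.checkDomRowG P κ p i = true) :
    c.checkBlockP P κ p = true := by
  unfold checkBlockP
  rw [Bool.and_eq_true]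
  constructor
  · unfold checkDC
    exact WeilCert2.allBelow_of_forall fun i hi ↦ hdc i hi
  · unfold checkDom
    refine WeilCert2.allBelow_of_forall fun i hi ↦ ?_
    rw [decide_eq_true_eq, sumR_eq_sum]
    have h := hdom i hi
    unfold checkDomRowG at h
    rw [decide_eq_true_eq, sumR_eq_sum, getV_rRowG P κ p hi hi] at h
    refine le_trans (le_of_eq ?_) h
    refine Finset.sum_congr rfl fun j hj ↦ ?_
    have hj' := Finset.mem_range.1 hj
    by_cases hji : j = i
    · rw [if_pos hji, if_pos hji]
    · rw [if_neg hji, if_neg hji, getV_rRowG P κ p hi hj', ← getM_rBlkP_symm hP κ p hi hj']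
      ring

/-! ## Dominance rows from the materialized and factored data -/

/-- A checked claim row gives the entries of `P`. [folklore] -/
theorem getM_of_checkPmRowG {P : ℕ → ℕ → ℚ} {Pm : List (List ℚ)} {p k : ℕ}
    (h : c.checkPmRowG P Pm p k = true) {l : ℕ} (hl : l < c.nb) :
    getM Pm k l = P (2 * k + p) (2 * l + p) := by
  unfold checkPmRowG at h
  have := of_allBelow h hl
  rwa [decide_eq_true_eq] at this

/-- With all claim rows checked, the materialized `Dᵀ P` row is the genuine one. [folklore] -/
theorem dtpRowP_eq_dtpRowG {P : ℕ → ℕ → ℚ} {Pm : List (List ℚ)} {p : ℕ}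
    (hPm : ∀ k < c.nb, c.checkPmRowG P Pm p k = true) (i : ℕ) :
    c.dtpRowP Pm p i = c.dtpRowG P p i := by
  unfold dtpRowP dtpRowG tabV
  refine List.map_congr_left fun l hl ↦ ?_
  rw [List.mem_range] at hl
  rw [sumR_eq_sum, sumR_eq_sum]
  refine Finset.sum_congr rfl fun k hk ↦ ?_
  rw [getM_of_checkPmRowG (hPm k (Finset.mem_range.1 hk)) hl]

/-- With all claim rows checked, the materialized row of `R` is the genuine one. [folklore] -/
theorem rRowP_eq_rRowG {P : ℕ → ℕ → ℚ} {Pm : List (List ℚ)} {p : ℕ}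
    (hPm : ∀ k < c.nb, c.checkPmRowG P Pm p k = true) (κ : ℚ) (i : ℕ) :
    c.rRowP Pm κ p i = c.rRowG P κ p i := by
  unfold rRowP rRowG
  dsimp only
  rw [dtpRowP_eq_dtpRowG hPm i]

/-- **`checkDomRowG` from the materialized block.** [folklore] -/
theorem checkDomRowG_of_P {P : ℕ → ℕ → ℚ} {Pm : List (List ℚ)} {κ : ℚ} {p i : ℕ}
    (hPm : ∀ k < c.nb, c.checkPmRowG P Pm p k = true) (h : c.checkDomRowP Pm κ p i = true) :
    c.checkDomRowG P κ p i = true := by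
  unfold checkDomRowP at h
  unfold checkDomRowG
  dsimp only at h ⊢
  rwa [rRowP_eq_rRowG hPm κ i] at h

/-- **`checkDomRowG` from the factored data** (`Pm`, `Dn/Ls`, `Hp`). [folklore] -/
theorem checkDomRowG_of_PZ {P : ℕ → ℕ → ℚ} {Pm Dn : List (List ℚ)} {Ls : List ℚ} {Hp : List (List ℚ)} {κ : ℚ}
    {p i : ℕ} (hi : i < c.nb)
    (hPm : ∀ k < c.nb, c.checkPmRowG P Pm p k = true) (hDn : ∀ k < c.nb, c.checkDnRow Dn Ls p k = true)
    (hHp : ∀ i < c.nb, c.checkHpRow Hp p i = true) (h : c.checkDomRowPZ Pm Dn Ls Hp κ p i = true) :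
    c.checkDomRowG P κ p i = true := by
  refine checkDomRowG_of_P hPm ?_
  unfold checkDomRowPZ at h
  unfold checkDomRowP
  dsimp only at h ⊢
  rw [decide_eq_true_eq] at h ⊢
  rw [sumR_eq_sum] at h ⊢
  have hdiag := getV_rRowPZ_eq (Pm := Pm) hDn hHp κ hi hi
  rw [hdiag] at h
  refine le_trans (le_of_eq ?_) h
  refine Finset.sum_congr rfl fun j hj ↦ ?_
  by_cases hji : j = i
  · rw [if_pos hji, if_pos hji]
  · rw [if_neg hji, if_neg hji, getV_rRowPZ_eq (Pm := Pm) hDn hHp κ hi (Finset.mem_range.1 hj)]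

end WeilCert

end Literature.NumberTheory.LFunctions
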